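import Summits.QuantumFields.YangMills.Theorems.PoincareLipschitzKuhnFloorBlowDownSeamLetters
import Summits.QuantumFields.YangMills.Theorems.PoincareLipschitzKuhnBlowDown
import HarnessLib

/-!
# LINE 25 «CompactnessTransfer» (K2 crux `BlockLipschitzL` stmt-QuantumFields-23533 ∕ crux `HistoryTailL` stmt-QuantumFields-19936), S2′ infrastructure:
# ★★★ THE SEAM (E′) — THE KUHN BLOW-DOWNS AND Γ1's PIECEWISE-CONSTANT BLOW-DOWNS ARE `L²(Q)`-CLOSE, SO THEY SHARE Γ1's LIMIT

Cell `ym3-torus` (YM ladder rung R3 = continuum SU(2) Yang–Mills on the three-torus — a RUNG, NOT the Clay problem: not `d = 4`, not infinite volume,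
not a mass gap); width seat `ym-ust-19936-w4` gen 15, second hand to the Γ1 seat `ym3-torus-px3` g7 (seam (E′) named 2026-08-29T11:18:43Z).
THEOREMS ONLY (def-free); `--supports` the K2 crux as a helper.  Letters VERBATIM from B3-a (`PoincareLipschitzKuhnBlowDown.blowDown_package`: `φ, hφ, S, u,
I, hI, c, hc, J, hJ`) and from Γ1-PC (`blowDown_L2_compact`: `x ↦ u (z + ⌊R·x⌋)` on `Q = {|xᵢ| < 1}`, `U` a.e.-strongly measurable and unit a.e. on `Q`,
`L²(Q)`-convergence as `Tendsto (∫_Q ‖· − U‖²) atTop (𝓝 0)`).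
* §4 ★★★`integral_normSq_kuhnBlowDown_sub_floorBlowDown_le` — for unit data on `box z (R+1)`, `R ≥ 1`:
  `∫_Q ‖J x − u (z + ⌊Rx⌋)‖² ≤ 150·(R³)⁻¹·Σ_{w ∈ box z (R+1)} Σ_μ ‖u (w + e_μ) − u w‖²` (§1 change of variables + (E′-core) + (E′-shift) of the letters file +
  `‖a − b‖² ≤ 2‖a − m‖² + 2‖m − b‖²`); ★`…_of_energy` — `≤ 300Λ₀∕R²` under `E(box z (R+1)) ≤ Λ₀(R+1)`.
* §5 ★★`tendsto_kuhnBlowDown_of_tendsto_floorBlowDown` — along any strictly increasing `ψ`, if Γ1's blow-downs of `u (ψ k)` converge to `U` in `L²(Q)` then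
  so do the Kuhn blow-downs `J (ψ k)` (`R k ≥ k + 1`): the Γ2∕Γ4 pens' entry to the SAME limit.
HONEST: a seam; nothing of Γ1, S2′, the organ `hImproveCoreFlat`, K1, `MeanDeviationL`, `BlockLipschitzL`, `HistoryTailL` or any rung statement is proved.
[folklore] ([AlicandroCicalese2008] §2; elementary measure theory).
-/

open scoped BigOperators Pointwise
open Literature.MathematicalPhysics.QuantumFieldTheory.Balaban1983to89 B4Eq19LatticeOperators

noncomputable section

namespace Summit.QuantumFields.YangMills.Theorems.PoincareLipschitzKuhnFloorBlowDownSeam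

open MeasureTheory Metric
open Summit.QuantumFields.YangMills.Theorems.PoincareLipschitzKuhnHat
open Summit.QuantumFields.YangMills.Theorems.PoincareLipschitzKuhnInterpolant
open Summit.QuantumFields.YangMills.Theorems.PoincareLipschitzKuhnSimplexVolume
open Summit.QuantumFields.YangMills.Theorems.PoincareLipschitzKuhnPathSums
open Summit.QuantumFields.YangMills.Theorems.PoincareLipschitzKuhnEnergy
open Summit.QuantumFields.YangMills.Theorems.PoincareLipschitzKuhnSphereDistance
open Summit.QuantumFields.YangMills.Theorems.PoincareLipschitzBlowDownRescale
open Summit.QuantumFields.YangMills.Theorems.PoincareLipschitzKuhnBlowDown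
open Summit.QuantumFields.YangMills.Theorems.PoincareLipschitzBlowDownCells
open Summit.QuantumFields.YangMills.Theorems.PoincareLipschitzLatticeTranslationPaths
open Summit.QuantumFields.YangMills.Theorems.PoincareLipschitzSamplingCells (absCube_subset_closedBall)

variable {E : Type*} [NormedAddCommGroup E] [NormedSpace ℝ E]
variable (φ : (Fin 3 → ℝ) → ℝ)

open Summit.QuantumFields.YangMills.Theorems.PoincareLipschitzKuhnFloorBlowDownSeamLetters

/-! ## §4 ★★★ (E′) The Kuhn blow-down and Γ1's piecewise-constant blow-down are `L²(Q)`-close: `≤ 150·R⁻³·E(box z (R+1))` -/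

omit [NormedSpace ℝ E] in
/-- `‖a − b‖² ≤ 2‖a − m‖² + 2‖m − b‖²`. [folklore] -/
theorem norm_sub_sq_le_two (a b m : E) : ‖a - b‖ ^ 2 ≤ 2 * ‖a - m‖ ^ 2 + 2 * ‖m - b‖ ^ 2 := by
  have h := norm_sub_le_norm_sub_add_norm_sub a m b
  nlinarith [norm_nonneg (a - b), norm_nonneg (a - m), norm_nonneg (m - b), sq_nonneg (‖a - m‖ - ‖m - b‖)]

/-- ★★★ **(E′) THE SEAM**: for unit lattice data `u : ℤ³ → S³ ⊂ ℝ⁴` on `box z (R+1)` (`R ≥ 1`), its Kuhn interpolant `I` (`hI`) and the Kuhn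
blow-down `J x = I (c + (R+½)•x)`, `cᵢ = zᵢ + ½` of `PoincareLipschitzKuhnBlowDown.blowDown_package`, the `L²` distance on the open unit cube to
Γ1's piecewise-constant blow-down `x ↦ u (z + ⌊R x⌋)` (`PoincareLipschitzBlowDownL2Compactness.blowDown_L2_compact`'s letters) obeys
`∫_{|xᵢ|<1} ‖J x − u (z + ⌊Rx⌋)‖² ≤ 150 · (R³)⁻¹ · Σ_{w ∈ box z (R+1)} Σ_μ ‖u (w + e_μ) − u w‖²` — so under the organ's `E ≤ Λ₀(R+1)` it is
`≤ 300Λ₀∕R² → 0`: along Γ1's subsequence the Kuhn blow-downs converge in `L²(Q)` to the SAME limit `U`. Assembly: §1 change of variables +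
§2 (E′-core) + §3 (E′-shift) + `‖a − b‖² ≤ 2‖a − m‖² + 2‖m − b‖²`. [folklore] -/
theorem integral_normSq_kuhnBlowDown_sub_floorBlowDown_le
    (hφ : ∀ t, φ t = max 0 (1 + min 0 (min (t 0) (min (t 1) (t 2))) - max 0 (max (t 0) (max (t 1) (t 2)))))
    (S : Finset (Zd 3)) (u : Zd 3 → EuclideanSpace ℝ (Fin 4)) (I : EuclideanSpace ℝ (Fin 3) → EuclideanSpace ℝ (Fin 4))
    (hI : ∀ x, I x = ∑ w ∈ S, φ (fun i => x i - (w i : ℝ)) • u w) (hu : ∀ w, ‖u w‖ = 1)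
    (z : Zd 3) (R : ℤ) (hR : 1 ≤ R) (hS : ∀ w ∈ box z (R + 1), w ∈ S)
    (c : EuclideanSpace ℝ (Fin 3)) (hc : ∀ i, c i = (z i : ℝ) + 1 / 2)
    (J : EuclideanSpace ℝ (Fin 3) → EuclideanSpace ℝ (Fin 4)) (hJ : ∀ x, J x = I (c + ((R : ℝ) + 1 / 2) • x)) :
    ∫ x in {x : EuclideanSpace ℝ (Fin 3) | ∀ i, |x i| < 1}, ‖J x - u (z + fun i => ⌊(R : ℝ) * x i⌋)‖ ^ 2 ≤
      150 * ((R : ℝ) ^ 3)⁻¹ * ∑ w ∈ box z (R + 1), ∑ μ : Fin 3, ‖u (w + unitVec μ) - u w‖ ^ 2 := by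
  have hR0 : (0 : ℝ) < R := by exact_mod_cast (by omega : (0 : ℤ) < R)
  have hR' : (0 : ℝ) < (R : ℝ) + 1 / 2 := by positivity
  set Eb : ℝ := ∑ w ∈ box z (R + 1), ∑ μ : Fin 3, ‖u (w + unitVec μ) - u w‖ ^ 2 with hEb
  have hEb0 : 0 ≤ Eb := Finset.sum_nonneg fun w _ => Finset.sum_nonneg fun μ _ => by positivity
  set m : EuclideanSpace ℝ (Fin 3) → EuclideanSpace ℝ (Fin 4) :=
    fun x => u (fun i => ⌊(c + ((R : ℝ) + 1 / 2) • x) i⌋) with hm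
  set f : EuclideanSpace ℝ (Fin 3) → EuclideanSpace ℝ (Fin 4) := fun x => u (z + fun i => ⌊(R : ℝ) * x i⌋) with hf
  have hmeasQ : MeasurableSet {x : EuclideanSpace ℝ (Fin 3) | ∀ i, |x i| < 1} := measurableSet_centredCube 1
  have hfinQ : volume {x : EuclideanSpace ℝ (Fin 3) | ∀ i, |x i| < 1} ≠ ⊤ := volume_unitCube_lt_top.ne
  -- measurability and bounds
  have hJcont : Continuous J := by
    rw [show J = fun x => I (c + ((R : ℝ) + 1 / 2) • x) from funext hJ]
    exact (continuous_interp φ hφ S u I hI).comp (continuous_const.add (continuous_id.const_smul ((R : ℝ) + 1 / 2)))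
  have hmm : Measurable m := measurable_comp_floor_affine u c _
  have hfm : Measurable f := measurable_comp_floorVec (fun y => u (z + y)) (R : ℝ)
  have hJle : ∀ x ∈ {x : EuclideanSpace ℝ (Fin 3) | ∀ i, |x i| < 1}, ‖J x‖ ≤ 1 :=
    (blowDown_package φ hφ S u I hI hu z R (by omega) hS c hc J hJ).1
  -- the three integrands on the cube
  have hintJf : IntegrableOn (fun x => ‖J x - f x‖ ^ 2) {x : EuclideanSpace ℝ (Fin 3) | ∀ i, |x i| < 1} volume := by
    refine Measure.integrableOn_of_bounded (M := 4) hfinQ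
      ((hJcont.measurable.sub hfm).norm.pow_const 2).aestronglyMeasurable ?_
    refine (ae_restrict_iff' hmeasQ).mpr (ae_of_all _ fun x hx => ?_)
    rw [Real.norm_of_nonneg (by positivity)]
    have h := norm_sub_le (J x) (f x)
    have h1 := hJle x hx
    have h2 : ‖f x‖ = 1 := hu _
    nlinarith [norm_nonneg (J x - f x)]
  have hintJm : IntegrableOn (fun x => ‖J x - m x‖ ^ 2) {x : EuclideanSpace ℝ (Fin 3) | ∀ i, |x i| < 1} volume := by
    refine Measure.integrableOn_of_bounded (M := 4) hfinQ
      ((hJcont.measurable.sub hmm).norm.pow_const 2).aestronglyMeasurable ?_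
    refine (ae_restrict_iff' hmeasQ).mpr (ae_of_all _ fun x hx => ?_)
    rw [Real.norm_of_nonneg (by positivity)]
    have h := norm_sub_le (J x) (m x)
    have h1 := hJle x hx
    have h2 : ‖m x‖ = 1 := hu _
    nlinarith [norm_nonneg (J x - m x)]
  have hintmf : IntegrableOn (fun x => ‖m x - f x‖ ^ 2) {x : EuclideanSpace ℝ (Fin 3) | ∀ i, |x i| < 1} volume := by
    refine Measure.integrableOn_of_bounded (M := 4) hfinQ
      ((hmm.sub hfm).norm.pow_const 2).aestronglyMeasurable (ae_of_all _ fun x => ?_)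
    rw [Real.norm_of_nonneg (by positivity)]
    have h := norm_sub_le (m x) (f x)
    have h1 : ‖m x‖ = 1 := hu _
    have h2 : ‖f x‖ = 1 := hu _
    nlinarith [norm_nonneg (m x - f x)]
  -- split
  have hsum : IntegrableOn (fun x => 2 * ‖J x - m x‖ ^ 2 + 2 * ‖m x - f x‖ ^ 2)
      {x : EuclideanSpace ℝ (Fin 3) | ∀ i, |x i| < 1} volume :=
    (hintJm.const_mul 2).add (hintmf.const_mul 2)
  have hsplit : ∫ x in {x : EuclideanSpace ℝ (Fin 3) | ∀ i, |x i| < 1}, ‖J x - f x‖ ^ 2 ≤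
      2 * (∫ x in {x : EuclideanSpace ℝ (Fin 3) | ∀ i, |x i| < 1}, ‖J x - m x‖ ^ 2) +
      2 * (∫ x in {x : EuclideanSpace ℝ (Fin 3) | ∀ i, |x i| < 1}, ‖m x - f x‖ ^ 2) := by
    have h1 : ∫ x in {x : EuclideanSpace ℝ (Fin 3) | ∀ i, |x i| < 1}, ‖J x - f x‖ ^ 2 ≤
        ∫ x in {x : EuclideanSpace ℝ (Fin 3) | ∀ i, |x i| < 1}, (2 * ‖J x - m x‖ ^ 2 + 2 * ‖m x - f x‖ ^ 2) :=
      setIntegral_mono_on hintJf hsum hmeasQ fun x _ => norm_sub_sq_le_two (J x) (f x) (m x)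
    have h2 : ∫ x in {x : EuclideanSpace ℝ (Fin 3) | ∀ i, |x i| < 1}, (2 * ‖J x - m x‖ ^ 2 + 2 * ‖m x - f x‖ ^ 2) =
        (∫ x in {x : EuclideanSpace ℝ (Fin 3) | ∀ i, |x i| < 1}, 2 * ‖J x - m x‖ ^ 2) +
        ∫ x in {x : EuclideanSpace ℝ (Fin 3) | ∀ i, |x i| < 1}, 2 * ‖m x - f x‖ ^ 2 :=
      integral_add (hintJm.const_mul 2) (hintmf.const_mul 2)
    have h3 : ∫ x in {x : EuclideanSpace ℝ (Fin 3) | ∀ i, |x i| < 1}, 2 * ‖J x - m x‖ ^ 2 =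
        2 * ∫ x in {x : EuclideanSpace ℝ (Fin 3) | ∀ i, |x i| < 1}, ‖J x - m x‖ ^ 2 := integral_const_mul _ _
    have h4 : ∫ x in {x : EuclideanSpace ℝ (Fin 3) | ∀ i, |x i| < 1}, 2 * ‖m x - f x‖ ^ 2 =
        2 * ∫ x in {x : EuclideanSpace ℝ (Fin 3) | ∀ i, |x i| < 1}, ‖m x - f x‖ ^ 2 := integral_const_mul _ _
    linarith
  -- first term: change of variables + (E′-core)
  have hfirst : ∫ x in {x : EuclideanSpace ℝ (Fin 3) | ∀ i, |x i| < 1}, ‖J x - m x‖ ^ 2 ≤ 3 * ((R : ℝ) ^ 3)⁻¹ * Eb := by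
    have e1 : ∫ x in {x : EuclideanSpace ℝ (Fin 3) | ∀ i, |x i| < 1}, ‖J x - m x‖ ^ 2 =
        ∫ x in {x : EuclideanSpace ℝ (Fin 3) | ∀ i, |x i| < 1},
          (fun X => ‖I X - u (fun i => ⌊X i⌋)‖ ^ 2) (c + ((R : ℝ) + 1 / 2) • x) := by
      refine setIntegral_congr_fun hmeasQ fun x _ => ?_
      simp only [hJ x, hm]
    rw [e1, setIntegral_centredCube_comp_affine (fun X => ‖I X - u (fun i => ⌊X i⌋)‖ ^ 2) c hR' 1,
      affineBox_eq_bigBox z R c hc]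
    have hcore := integral_bigBox_normSq_interp_sub_floor_le φ hφ S u I hI hu z R hS
    have hinv : (((R : ℝ) + 1 / 2) ^ 3)⁻¹ ≤ ((R : ℝ) ^ 3)⁻¹ :=
      inv_anti₀ (by positivity) (pow_le_pow_left₀ hR0.le (by linarith) 3)
    calc (((R : ℝ) + 1 / 2) ^ 3)⁻¹ * ∫ X in {X : EuclideanSpace ℝ (Fin 3) | ∀ i, (z i : ℝ) - R < X i ∧ X i < z i + R + 1},
            ‖I X - u (fun i => ⌊X i⌋)‖ ^ 2
        ≤ (((R : ℝ) + 1 / 2) ^ 3)⁻¹ * (3 * Eb) := mul_le_mul_of_nonneg_left hcore (by positivity)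
      _ ≤ ((R : ℝ) ^ 3)⁻¹ * (3 * Eb) := mul_le_mul_of_nonneg_right hinv (by positivity)
      _ = 3 * ((R : ℝ) ^ 3)⁻¹ * Eb := by ring
  -- second term: (E′-shift)
  have hsecond : ∫ x in {x : EuclideanSpace ℝ (Fin 3) | ∀ i, |x i| < 1}, ‖m x - f x‖ ^ 2 ≤ 72 * ((R : ℝ) ^ 3)⁻¹ * Eb :=
    integral_normSq_floorShift_le u hu z R hR c hc
  have hgoal : ∫ x in {x : EuclideanSpace ℝ (Fin 3) | ∀ i, |x i| < 1}, ‖J x - f x‖ ^ 2 ≤ 150 * ((R : ℝ) ^ 3)⁻¹ * Eb := by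
    calc ∫ x in {x : EuclideanSpace ℝ (Fin 3) | ∀ i, |x i| < 1}, ‖J x - f x‖ ^ 2
        ≤ 2 * (3 * ((R : ℝ) ^ 3)⁻¹ * Eb) + 2 * (72 * ((R : ℝ) ^ 3)⁻¹ * Eb) := by linarith
      _ = 150 * ((R : ℝ) ^ 3)⁻¹ * Eb := by ring
  exact hgoal

/-- ★ **(E′) under the organ's energy bound**: if `E(box z (R+1)) ≤ Λ₀ (R+1)` then the `L²(Q)` distance is `≤ 300 Λ₀ ∕ R²`. [folklore] -/
theorem integral_normSq_kuhnBlowDown_sub_floorBlowDown_le_of_energy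
    (hφ : ∀ t, φ t = max 0 (1 + min 0 (min (t 0) (min (t 1) (t 2))) - max 0 (max (t 0) (max (t 1) (t 2)))))
    (S : Finset (Zd 3)) (u : Zd 3 → EuclideanSpace ℝ (Fin 4)) (I : EuclideanSpace ℝ (Fin 3) → EuclideanSpace ℝ (Fin 4))
    (hI : ∀ x, I x = ∑ w ∈ S, φ (fun i => x i - (w i : ℝ)) • u w) (hu : ∀ w, ‖u w‖ = 1)
    (z : Zd 3) (R : ℤ) (hR : 1 ≤ R) (hS : ∀ w ∈ box z (R + 1), w ∈ S)
    (c : EuclideanSpace ℝ (Fin 3)) (hc : ∀ i, c i = (z i : ℝ) + 1 / 2)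
    (J : EuclideanSpace ℝ (Fin 3) → EuclideanSpace ℝ (Fin 4)) (hJ : ∀ x, J x = I (c + ((R : ℝ) + 1 / 2) • x))
    {Λ₀ : ℝ} (hE : ∑ w ∈ box z (R + 1), ∑ μ : Fin 3, ‖u (w + unitVec μ) - u w‖ ^ 2 ≤ Λ₀ * ((R : ℝ) + 1)) :
    ∫ x in {x : EuclideanSpace ℝ (Fin 3) | ∀ i, |x i| < 1}, ‖J x - u (z + fun i => ⌊(R : ℝ) * x i⌋)‖ ^ 2 ≤
      300 * Λ₀ / (R : ℝ) ^ 2 := by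
  have hR1 : (1 : ℝ) ≤ R := by exact_mod_cast hR
  have hR0 : (0 : ℝ) < R := by linarith
  have h := integral_normSq_kuhnBlowDown_sub_floorBlowDown_le φ hφ S u I hI hu z R hR hS c hc J hJ
  have hE0 : 0 ≤ ∑ w ∈ box z (R + 1), ∑ μ : Fin 3, ‖u (w + unitVec μ) - u w‖ ^ 2 :=
    Finset.sum_nonneg fun w _ => Finset.sum_nonneg fun μ _ => by positivity
  have hΛ : 0 ≤ Λ₀ * ((R : ℝ) + 1) := le_trans hE0 hE
  have hΛ0 : 0 ≤ Λ₀ := nonneg_of_mul_nonneg_left hΛ (by linarith)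
  refine h.trans ?_
  rw [div_eq_mul_inv]
  have e3 : ((R : ℝ) ^ 3)⁻¹ = ((R : ℝ) ^ 2)⁻¹ * (R : ℝ)⁻¹ := by
    rw [← mul_inv]
    ring
  rw [e3]
  have hR1' : ((R : ℝ) + 1) * (R : ℝ)⁻¹ ≤ 2 := by
    rw [mul_inv_le_iff₀ hR0]; linarith
  have hpos : 0 ≤ ((R : ℝ) ^ 2)⁻¹ := by positivity
  calc 150 * (((R : ℝ) ^ 2)⁻¹ * (R : ℝ)⁻¹) * ∑ w ∈ box z (R + 1), ∑ μ : Fin 3, ‖u (w + unitVec μ) - u w‖ ^ 2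
      ≤ 150 * (((R : ℝ) ^ 2)⁻¹ * (R : ℝ)⁻¹) * (Λ₀ * ((R : ℝ) + 1)) :=
        mul_le_mul_of_nonneg_left hE (by positivity)
    _ = 150 * ((R : ℝ) ^ 2)⁻¹ * Λ₀ * (((R : ℝ) + 1) * (R : ℝ)⁻¹) := by ring
    _ ≤ 150 * ((R : ℝ) ^ 2)⁻¹ * Λ₀ * 2 :=
        mul_le_mul_of_nonneg_left hR1' (by positivity)
    _ = 300 * Λ₀ * ((R : ℝ) ^ 2)⁻¹ := by ring

/-! ## §5 ★★ (E′) consumed: along Γ1's subsequence the Kuhn blow-downs converge in `L²(Q)` to the SAME limit `U` -/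

/-- ★★ **TRANSFER OF Γ1's LIMIT TO THE KUHN BLOW-DOWNS.**  Let `u k : ℤ³ → S³ ⊂ ℝ⁴` be unit lattice maps with
`E(box (z k) (R k + 1)) ≤ Λ₀ (R k + 1)`, `R k ≥ k + 1`, `I k` their Kuhn interpolants and `J k x = I k (c k + (R k + ½)•x)` their Kuhn blow-downs
(`PoincareLipschitzKuhnBlowDown.blowDown_package`).  If along `ψ` Γ1's piecewise-constant blow-downs converge in `L²(Q)` to a unit a.e., a.e.-strongly
measurable `U` (the conjuncts (c2)(c3) of `blowDown_L2_compact`), then so do the Kuhn blow-downs: `∫_Q ‖J (ψ k) − U‖² → 0`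
(`≤ 2·300Λ₀∕R(ψk)² + 2∫_Q ‖f_{ψk} − U‖²`, §4). [folklore] -/
theorem tendsto_kuhnBlowDown_of_tendsto_floorBlowDown
    (hφ : ∀ t, φ t = max 0 (1 + min 0 (min (t 0) (min (t 1) (t 2))) - max 0 (max (t 0) (max (t 1) (t 2)))))
    (u : ℕ → Zd 3 → EuclideanSpace ℝ (Fin 4)) (z : ℕ → Zd 3) (R : ℕ → ℤ)
    (hR : ∀ k : ℕ, (k : ℝ) + 1 ≤ R k) (hu : ∀ (k : ℕ) (y : Zd 3), ‖u k y‖ = 1) {Λ₀ : ℝ}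
    (hE : ∀ k : ℕ, ∑ w ∈ box (z k) (R k + 1), ∑ μ : Fin 3, ‖u k (w + unitVec μ) - u k w‖ ^ 2 ≤ Λ₀ * ((R k : ℝ) + 1))
    (S : ℕ → Finset (Zd 3)) (hS : ∀ k : ℕ, ∀ w ∈ box (z k) (R k + 1), w ∈ S k)
    (I : ℕ → EuclideanSpace ℝ (Fin 3) → EuclideanSpace ℝ (Fin 4))
    (hI : ∀ (k : ℕ) (x : EuclideanSpace ℝ (Fin 3)), I k x = ∑ w ∈ S k, φ (fun i => x i - (w i : ℝ)) • u k w)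
    (c : ℕ → EuclideanSpace ℝ (Fin 3)) (hc : ∀ (k : ℕ) (i : Fin 3), c k i = (z k i : ℝ) + 1 / 2)
    (J : ℕ → EuclideanSpace ℝ (Fin 3) → EuclideanSpace ℝ (Fin 4))
    (hJ : ∀ (k : ℕ) (x : EuclideanSpace ℝ (Fin 3)), J k x = I k (c k + ((R k : ℝ) + 1 / 2) • x))
    (U : EuclideanSpace ℝ (Fin 3) → EuclideanSpace ℝ (Fin 4))
    (hUm : AEStronglyMeasurable U (volume.restrict {x : EuclideanSpace ℝ (Fin 3) | ∀ i, |x i| < 1}))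
    (hU1 : ∀ᵐ x ∂(volume.restrict {x : EuclideanSpace ℝ (Fin 3) | ∀ i, |x i| < 1}), ‖U x‖ = 1)
    (ψ : ℕ → ℕ) (hψ : StrictMono ψ)
    (hlim : Filter.Tendsto (fun k : ℕ => ∫ x in {x : EuclideanSpace ℝ (Fin 3) | ∀ i, |x i| < 1},
        ‖u (ψ k) (z (ψ k) + fun i => ⌊(R (ψ k) : ℝ) * x i⌋) - U x‖ ^ 2) Filter.atTop (nhds 0)) :
    Filter.Tendsto (fun k : ℕ => ∫ x in {x : EuclideanSpace ℝ (Fin 3) | ∀ i, |x i| < 1}, ‖J (ψ k) x - U x‖ ^ 2)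
      Filter.atTop (nhds 0) := by
  have hmeasQ : MeasurableSet {x : EuclideanSpace ℝ (Fin 3) | ∀ i, |x i| < 1} := measurableSet_centredCube 1
  have hfinQ : volume {x : EuclideanSpace ℝ (Fin 3) | ∀ i, |x i| < 1} ≠ ⊤ := volume_unitCube_lt_top.ne
  have hR1 : ∀ k, (1 : ℤ) ≤ R k := fun k => by
    have h := hR k
    have hk : (0 : ℝ) ≤ k := Nat.cast_nonneg k
    exact_mod_cast (show (1 : ℝ) ≤ R k by linarith)
  have hΛ0 : 0 ≤ Λ₀ := by
    have h0 : 0 ≤ ∑ w ∈ box (z 0) (R 0 + 1), ∑ μ : Fin 3, ‖u 0 (w + unitVec μ) - u 0 w‖ ^ 2 :=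
      Finset.sum_nonneg fun w _ => Finset.sum_nonneg fun μ _ => by positivity
    have h1 : (0 : ℝ) < (R 0 : ℝ) + 1 := by have := hR 0; push_cast at this; linarith
    exact nonneg_of_mul_nonneg_left (h0.trans (hE 0)) h1
  -- the per-index bound `∫_Q ‖J (ψ k) − U‖² ≤ 600Λ₀·(1∕(k+1)) + 2 b_k`
  have hbound : ∀ k : ℕ, ∫ x in {x : EuclideanSpace ℝ (Fin 3) | ∀ i, |x i| < 1}, ‖J (ψ k) x - U x‖ ^ 2 ≤
      600 * Λ₀ * (1 / ((k : ℝ) + 1)) + 2 * ∫ x in {x : EuclideanSpace ℝ (Fin 3) | ∀ i, |x i| < 1},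
        ‖u (ψ k) (z (ψ k) + fun i => ⌊(R (ψ k) : ℝ) * x i⌋) - U x‖ ^ 2 := by
    intro k
    set n := ψ k with hn
    have hJcont : Continuous (J n) := by
      rw [show J n = fun x => I n (c n + ((R n : ℝ) + 1 / 2) • x) from funext (hJ n)]
      exact (continuous_interp φ hφ (S n) (u n) (I n) (hI n)).comp
        (continuous_const.add (continuous_id.const_smul ((R n : ℝ) + 1 / 2)))
    have hfm : Measurable fun x : EuclideanSpace ℝ (Fin 3) => u n (z n + fun i => ⌊(R n : ℝ) * x i⌋) :=
      measurable_comp_floorVec (fun y => u n (z n + y)) (R n : ℝ)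
    have hJle : ∀ x ∈ {x : EuclideanSpace ℝ (Fin 3) | ∀ i, |x i| < 1}, ‖J n x‖ ≤ 1 :=
      (blowDown_package φ hφ (S n) (u n) (I n) (hI n) (hu n) (z n) (R n) (by have := hR1 n; omega) (hS n)
        (c n) (hc n) (J n) (hJ n)).1
    have hUm' : AEStronglyMeasurable U (volume.restrict {x : EuclideanSpace ℝ (Fin 3) | ∀ i, |x i| < 1}) := hUm
    -- integrability of the three squared distances on `Q`
    haveI hfinI : IsFiniteMeasure (volume.restrict {x : EuclideanSpace ℝ (Fin 3) | ∀ i, |x i| < 1}) :=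
      ⟨by rw [Measure.restrict_apply_univ]; exact volume_unitCube_lt_top⟩
    have hmeasJU : AEStronglyMeasurable (fun x => ‖J n x - U x‖ ^ 2)
        (volume.restrict {x : EuclideanSpace ℝ (Fin 3) | ∀ i, |x i| < 1}) :=
      (hJcont.aestronglyMeasurable.sub hUm').norm.pow 2
    have hintJU : IntegrableOn (fun x => ‖J n x - U x‖ ^ 2) {x : EuclideanSpace ℝ (Fin 3) | ∀ i, |x i| < 1} volume := by
      refine memLp_one_iff_integrable.1 (MemLp.of_bound hmeasJU 4 ?_)
      filter_upwards [hU1, (ae_restrict_iff' hmeasQ).mpr (ae_of_all _ hJle)] with x hx1 hx2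
      rw [Real.norm_of_nonneg (by positivity)]
      have h := norm_sub_le (J n x) (U x)
      nlinarith [norm_nonneg (J n x - U x)]
    have hmeasfU : AEStronglyMeasurable (fun x => ‖u n (z n + fun i => ⌊(R n : ℝ) * x i⌋) - U x‖ ^ 2)
        (volume.restrict {x : EuclideanSpace ℝ (Fin 3) | ∀ i, |x i| < 1}) :=
      (hfm.aestronglyMeasurable.sub hUm').norm.pow 2
    have hintfU : IntegrableOn (fun x => ‖u n (z n + fun i => ⌊(R n : ℝ) * x i⌋) - U x‖ ^ 2)
        {x : EuclideanSpace ℝ (Fin 3) | ∀ i, |x i| < 1} volume := by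
      refine memLp_one_iff_integrable.1 (MemLp.of_bound hmeasfU 4 ?_)
      filter_upwards [hU1] with x hx1
      rw [Real.norm_of_nonneg (by positivity)]
      have h := norm_sub_le (u n (z n + fun i => ⌊(R n : ℝ) * x i⌋)) (U x)
      rw [hu] at h
      nlinarith [norm_nonneg (u n (z n + fun i => ⌊(R n : ℝ) * x i⌋) - U x)]
    have hintJf : IntegrableOn (fun x => ‖J n x - u n (z n + fun i => ⌊(R n : ℝ) * x i⌋)‖ ^ 2)
        {x : EuclideanSpace ℝ (Fin 3) | ∀ i, |x i| < 1} volume := by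
      refine Measure.integrableOn_of_bounded (M := 4) hfinQ
        ((hJcont.measurable.sub hfm).norm.pow_const 2).aestronglyMeasurable ?_
      refine (ae_restrict_iff' hmeasQ).mpr (ae_of_all _ fun x hx => ?_)
      rw [Real.norm_of_nonneg (by positivity)]
      have h := norm_sub_le (J n x) (u n (z n + fun i => ⌊(R n : ℝ) * x i⌋))
      have h1 := hJle x hx
      rw [hu] at h
      nlinarith [norm_nonneg (J n x - u n (z n + fun i => ⌊(R n : ℝ) * x i⌋))]
    have hsum : IntegrableOn (fun x => 2 * ‖J n x - u n (z n + fun i => ⌊(R n : ℝ) * x i⌋)‖ ^ 2 +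
        2 * ‖u n (z n + fun i => ⌊(R n : ℝ) * x i⌋) - U x‖ ^ 2) {x : EuclideanSpace ℝ (Fin 3) | ∀ i, |x i| < 1} volume :=
      (hintJf.const_mul 2).add (hintfU.const_mul 2)
    have h1 : ∫ x in {x : EuclideanSpace ℝ (Fin 3) | ∀ i, |x i| < 1}, ‖J n x - U x‖ ^ 2 ≤
        ∫ x in {x : EuclideanSpace ℝ (Fin 3) | ∀ i, |x i| < 1}, (2 * ‖J n x - u n (z n + fun i => ⌊(R n : ℝ) * x i⌋)‖ ^ 2 +
          2 * ‖u n (z n + fun i => ⌊(R n : ℝ) * x i⌋) - U x‖ ^ 2) :=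
      setIntegral_mono_on hintJU hsum hmeasQ fun x _ =>
        norm_sub_sq_le_two (J n x) (U x) (u n (z n + fun i => ⌊(R n : ℝ) * x i⌋))
    have h2 : ∫ x in {x : EuclideanSpace ℝ (Fin 3) | ∀ i, |x i| < 1}, (2 * ‖J n x - u n (z n + fun i => ⌊(R n : ℝ) * x i⌋)‖ ^ 2 +
          2 * ‖u n (z n + fun i => ⌊(R n : ℝ) * x i⌋) - U x‖ ^ 2) =
        (∫ x in {x : EuclideanSpace ℝ (Fin 3) | ∀ i, |x i| < 1}, 2 * ‖J n x - u n (z n + fun i => ⌊(R n : ℝ) * x i⌋)‖ ^ 2) +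
        ∫ x in {x : EuclideanSpace ℝ (Fin 3) | ∀ i, |x i| < 1}, 2 * ‖u n (z n + fun i => ⌊(R n : ℝ) * x i⌋) - U x‖ ^ 2 :=
      integral_add (hintJf.const_mul 2) (hintfU.const_mul 2)
    have h3 : ∫ x in {x : EuclideanSpace ℝ (Fin 3) | ∀ i, |x i| < 1}, 2 * ‖J n x - u n (z n + fun i => ⌊(R n : ℝ) * x i⌋)‖ ^ 2 =
        2 * ∫ x in {x : EuclideanSpace ℝ (Fin 3) | ∀ i, |x i| < 1}, ‖J n x - u n (z n + fun i => ⌊(R n : ℝ) * x i⌋)‖ ^ 2 :=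
      integral_const_mul _ _
    have h4 : ∫ x in {x : EuclideanSpace ℝ (Fin 3) | ∀ i, |x i| < 1}, 2 * ‖u n (z n + fun i => ⌊(R n : ℝ) * x i⌋) - U x‖ ^ 2 =
        2 * ∫ x in {x : EuclideanSpace ℝ (Fin 3) | ∀ i, |x i| < 1}, ‖u n (z n + fun i => ⌊(R n : ℝ) * x i⌋) - U x‖ ^ 2 :=
      integral_const_mul _ _
    have h5 := integral_normSq_kuhnBlowDown_sub_floorBlowDown_le_of_energy φ hφ (S n) (u n) (I n) (hI n) (hu n)
      (z n) (R n) (hR1 n) (hS n) (c n) (hc n) (J n) (hJ n) (hE n)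
    -- `300Λ₀ ∕ R(ψk)² ≤ 300Λ₀ · 1∕(k+1)` since `R (ψ k) ≥ ψ k + 1 ≥ k + 1 ≥ 1`
    have hψk : k ≤ ψ k := hψ.id_le k
    have hRk : (k : ℝ) + 1 ≤ R n := by
      have h := hR n
      have : (k : ℝ) ≤ (ψ k : ℝ) := by exact_mod_cast hψk
      rw [hn]; linarith
    have hk1 : (0 : ℝ) < (k : ℝ) + 1 := by positivity
    have hRpos : (0 : ℝ) < R n := by linarith
    have h6 : 300 * Λ₀ / (R n : ℝ) ^ 2 ≤ 300 * Λ₀ * (1 / ((k : ℝ) + 1)) := by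
      rw [div_eq_mul_one_div]
      refine mul_le_mul_of_nonneg_left ?_ (by positivity)
      rw [one_div_le_one_div (by positivity) hk1]
      nlinarith
    linarith
  -- squeeze
  have hupper : Filter.Tendsto (fun k : ℕ => 600 * Λ₀ * (1 / ((k : ℝ) + 1)) +
      2 * ∫ x in {x : EuclideanSpace ℝ (Fin 3) | ∀ i, |x i| < 1},
        ‖u (ψ k) (z (ψ k) + fun i => ⌊(R (ψ k) : ℝ) * x i⌋) - U x‖ ^ 2) Filter.atTop (nhds 0) := by
    have h1 : Filter.Tendsto (fun k : ℕ => 600 * Λ₀ * (1 / ((k : ℝ) + 1))) Filter.atTop (nhds 0) := by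
      have := tendsto_one_div_add_atTop_nhds_zero_nat.const_mul (600 * Λ₀)
      simpa using this
    have h2 := hlim.const_mul 2
    simpa using h1.add h2
  refine tendsto_of_tendsto_of_tendsto_of_le_of_le tendsto_const_nhds hupper (fun k => ?_) hbound
  exact integral_nonneg fun x => by positivity

end Summit.QuantumFields.YangMills.Theorems.PoincareLipschitzKuhnFloorBlowDownSeam

end
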